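import Summits.MatrixMultiplication.MatrixMultiplication.Theorems.SaturationLadderExpSaturationDiagonal

/-!
# `ExpSaturation` (route `SaturationLadder`, stmt-MatrixMultiplication-25913) — file 2/3: the entropy
inequality `H(X) ≤ H(Y) = H(Z)` of the family in closed form (`entropyX_le_binEntropy_of`, `entropyNum`:
at `q = 4^{k+2}`, `l = 2 + 1/k` it reduces to `1/2 + 9/64 ≤ 3 log 2`), `famEntropy`, `famDiagonal`, and
layer C `famThreshold` — the analytic threshold (X-perfectness: `(q+2)^N = exp(N H_X) · (q^m)^{qk}` exactly).

Landing note: the lens-1 kernel `ExpSaturation.lean` (decomp-mm gen 4; sha256 de524bf9…328c, 913 lines,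
rc 0 · 0 sorry · std axioms, critic-endorsed 2026-08-30T04:10:26Z) is landed as three files for the gate rule
«Theorems files with proofs ≤ 400 lines» — `SaturationLadderExpSaturationDiagonal` (layers B1, B2),
`SaturationLadderExpSaturationEntropy` (the entropy inequality in closed form, `famEntropy`, `famDiagonal`,
layer C `famThreshold`) and `SaturationLadderExpSaturation` (assembly `ω(k+1,k,c) ≤ qk`, the entropy condition at
`q = 4^(k+2)`, the closers `expSaturation_holds` / `eventualTightness_holds`, and `subexpSaturation_above_log_four`);
statements and proofs are unchanged (one namespace `…Theorems.SaturationLadderExpSaturation` throughout), except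
that the two folklore identities `H(1−p,p,0) = H(p,1−p,0) = h(p)/log 2` — verbatim the tree's
`PerfectAmortisation.shannonEntropy_vec3_eq_binEntropy'` / `…_eq_binEntropy`, whose module
`Theorems/ShapeSubmodularityPerfectAmortisationStubCwRectEntropy.lean` has no farm olean at landing time
(rc 75 `remote:stale:unbuilt`) — are proved locally inside `famEntropy` instead of being restated
(gate rule `dedup.landed`); the helper files import no route (`Theses`) file (gate lint `theses-cone`).
The overview (certificate, references) is the module docstring of `Theorems/SaturationLadderExpSaturation.lean`.
-/

set_option linter.dupNamespace false
-- (single-conjunct summit: the namespace repeats `MatrixMultiplication`)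

noncomputable section

open Finset
open scoped BigOperators

namespace Summit.MatrixMultiplication.MatrixMultiplication.Theorems.SaturationLadderExpSaturation

open Literature.Computability.AlgebraicComplexity
open Literature.Barriers.MatrixMultiplication
open Summit.MatrixMultiplication.MatrixMultiplication.Theorems.PerfectAmortisation
  (stub_cwRectRestriction)

/-! ## The entropy inequality `H(X) ≤ H(Y) = H(Z)` of the family, in closed form -/

/-- **Abstract form.** For `0 < θ`, `2θ < 1`, `p = l θ < 1` with `l ≥ 2` and the numerical
condition `l log l + l² θ ≤ (l − 2)(1 − log θ)`:
`2 η(θ) + η(1 − 2θ) ≤ h(p)` — from `−log(1 − 2θ) ≤ 2θ/(1 − 2θ)` and `−log(1 − p) ≥ p`.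
[folklore] -/
theorem entropyX_le_binEntropy_of {θ p l : ℝ} (hθ : 0 < θ) (h2θ : 2 * θ < 1) (hpl : p = l * θ)
    (hl : 2 ≤ l) (hp1 : p < 1)
    (hnum : l * Real.log l + l ^ 2 * θ ≤ (l - 2) * (1 - Real.log θ)) :
    2 * Real.negMulLog θ + Real.negMulLog (1 - 2 * θ) ≤ Real.binEntropy p := by
  have hl0 : 0 < l := by linarith
  have hp0 : 0 < p := by rw [hpl]; positivity
  have hx : 0 < 1 - 2 * θ := by linarith
  have hy : 0 < 1 - p := by linarith
  -- `log (1 - p) ≤ -p`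
  have i1 : Real.log (1 - p) ≤ -p := by
    have := Real.log_le_sub_one_of_pos hy
    linarith
  have i1' : (1 - p) * p ≤ -(1 - p) * Real.log (1 - p) := by nlinarith [i1, hy]
  -- `-(1 - 2θ) log (1 - 2θ) ≤ 2θ`
  have i3 : (1 - 2 * θ) * (-Real.log (1 - 2 * θ)) ≤ 2 * θ := by
    have h := Real.one_sub_inv_le_log_of_pos hx
    have h' : (1 - 2 * θ) * (-Real.log (1 - 2 * θ)) ≤ (1 - 2 * θ) * ((1 - 2 * θ)⁻¹ - 1) :=
      mul_le_mul_of_nonneg_left (by linarith) hx.le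
    have e : (1 - 2 * θ) * ((1 - 2 * θ)⁻¹ - 1) = 2 * θ := by
      field_simp
      ring
    linarith
  -- `log p = log l + log θ`
  have elog : Real.log p = Real.log l + Real.log θ := by
    rw [hpl, Real.log_mul hl0.ne' hθ.ne']
  -- the numerical condition, multiplied by `θ`
  have key : θ * (l * Real.log l + l ^ 2 * θ) ≤ θ * ((l - 2) * (1 - Real.log θ)) :=
    mul_le_mul_of_nonneg_left hnum hθ.le
  rw [Real.binEntropy_eq_negMulLog_add_negMulLog_one_sub, Real.negMulLog, Real.negMulLog,
    Real.negMulLog, Real.negMulLog, elog]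
  rw [hpl] at i1' ⊢
  linarith [i3, i1', key]

/-- `4 k ≤ 4^k`. [folklore] -/
theorem four_mul_le_four_pow (k : ℕ) : 4 * k ≤ 4 ^ k := by
  induction k with
  | zero => simp
  | succ n ih =>
    have h1 : 1 ≤ 4 ^ n := Nat.one_le_pow _ _ (by norm_num)
    rw [pow_succ]
    omega

/-- `64 k ≤ 4^(k+2)`. [folklore] -/
theorem sixtyfour_mul_le_four_pow (k : ℕ) : 64 * k ≤ 4 ^ (k + 2) := by
  have h := four_mul_le_four_pow k
  rw [pow_add]
  norm_num
  omega

/-- **The numerical condition holds for `θ = 1/(G+2)`, `l = 2 + 1/k`** whenever `G ≥ 4^(k+2)`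
(`k ≥ 1`): `(2 + 1/k) log(2 + 1/k) + (2 + 1/k)²/(G+2) ≤ (1/k)(1 + log(G+2))`, because
`log(2 + 1/k) ≤ log 2 + 1/(2k)`, `(2+1/k)²/(G+2) ≤ 9/(64k)` and `log(G+2) ≥ (2k+4) log 2`, leaving
`1/2 + 9/64 ≤ 3 log 2`. [folklore] -/
theorem entropyNum (k : ℕ) (hk : 1 ≤ k) {G : ℝ} (hG : (4 : ℝ) ^ (k + 2) ≤ G) :
    (2 + 1 / (k : ℝ)) * Real.log (2 + 1 / (k : ℝ)) + (2 + 1 / (k : ℝ)) ^ 2 * (1 / (G + 2)) ≤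
      (2 + 1 / (k : ℝ) - 2) * (1 - Real.log (1 / (G + 2))) := by
  -- `log 4 = 2 log 2` is the landed `Literature.NumberTheory.LFunctions.FordLambda.log_4_eq`; proved locally
  -- (one line) rather than restated or imported across areas (gate rule `dedup.landed`).
  have log_four : Real.log 4 = 2 * Real.log 2 := by
    rw [show (4 : ℝ) = 2 ^ 2 by norm_num, Real.log_pow]; norm_num
  have hk0 : (0 : ℝ) < k := by exact_mod_cast hk
  have hk1 : (1 : ℝ) ≤ k := by exact_mod_cast hk
  have hG64k : 64 * (k : ℝ) ≤ G := by
    have h : ((64 * k : ℕ) : ℝ) ≤ ((4 ^ (k + 2) : ℕ) : ℝ) := by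
      exact_mod_cast sixtyfour_mul_le_four_pow k
    push_cast at h
    linarith
  have hGpos : 0 < G := by linarith
  have hG4pos : (0 : ℝ) < (4 : ℝ) ^ (k + 2) := by positivity
  have hlogθ : Real.log (1 / (G + 2)) = -Real.log (G + 2) := by
    rw [one_div, Real.log_inv]
  have F1 : (2 * k + 4) * Real.log 2 ≤ Real.log (G + 2) := by
    have h1 : Real.log ((4 : ℝ) ^ (k + 2)) ≤ Real.log (G + 2) :=
      Real.log_le_log hG4pos (by linarith)
    rw [Real.log_pow, log_four] at h1
    push_cast at h1
    linarith
  have F2 : Real.log (2 + 1 / (k : ℝ)) ≤ Real.log 2 + 1 / (2 * k) := by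
    have e : (2 : ℝ) + 1 / k = 2 * (1 + 1 / (2 * k)) := by
      field_simp
    have hpos : (0 : ℝ) < 1 + 1 / (2 * k) := by positivity
    rw [e, Real.log_mul two_ne_zero hpos.ne']
    have := Real.log_le_sub_one_of_pos hpos
    linarith
  have F3 : (2 + 1 / (k : ℝ)) ^ 2 * (1 / (G + 2)) ≤ 9 * (1 / (64 * k)) := by
    have a : (2 + 1 / (k : ℝ)) ^ 2 ≤ 9 := by
      have h1' : 1 / (k : ℝ) ≤ 1 := by
        rw [div_le_one hk0]
        exact hk1
      have h0 : 0 ≤ 1 / (k : ℝ) := by positivity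
      nlinarith
    have b : 1 / (G + 2) ≤ 1 / (64 * k) :=
      one_div_le_one_div_of_le (by positivity) (by linarith)
    exact mul_le_mul a b (by positivity) (by norm_num)
  have F4 := Real.log_two_gt_d9
  have F2' : (2 + 1 / (k : ℝ)) * Real.log (2 + 1 / (k : ℝ)) ≤
      (2 + 1 / (k : ℝ)) * (Real.log 2 + 1 / (2 * k)) :=
    mul_le_mul_of_nonneg_left F2 (by positivity)
  have hhalf : 1 / (2 * (k : ℝ)) ≤ 1 / 2 :=
    one_div_le_one_div_of_le (by norm_num) (by linarith)
  rw [hlogθ]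
  have hl : (2 + 1 / (k : ℝ) - 2) = 1 / k := by ring
  rw [hl]
  -- everything is now linear in the atoms `log 2`, `log (G+2)`, `1/k`, `1/(2k)`, `1/(64k)`, with the
  -- products `1/k · log 2`-free after clearing: we multiply the target through by `k`.
  have main : (2 + 1 / (k : ℝ)) * (Real.log 2 + 1 / (2 * k)) + 9 * (1 / (64 * k)) ≤
      1 / k * (1 - -Real.log (G + 2)) := by
    rw [← sub_nonneg]
    have e : 1 / (k : ℝ) * (1 - -Real.log (G + 2)) -
        ((2 + 1 / (k : ℝ)) * (Real.log 2 + 1 / (2 * k)) + 9 * (1 / (64 * k))) =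
        (1 / k) * ((1 + Real.log (G + 2)) - (2 * k + 1) * Real.log 2 - 1 - 1 / (2 * k) - 9 / 64) := by
      field_simp
      ring
    rw [e]
    exact mul_nonneg (by positivity) (by linarith)
  linarith [F2', F3, main]

/-- **Entropy layer (parametric).**  For `P = Q/N` (`Q = (m(k+1), mk, mc, mk)` on
`(1,1,0), (0,1,1), (1,0,1), (2,0,0)`, `N = (q+2)km`, `qk = k+1+c`), under the family's entropy
condition `2 η(1/(q+2)) + η(q/(q+2)) ≤ h((2k+1)/((q+2)k))`:
`log 2 · (min_m H(P_m) − Γ_S(P)) ≥ log(q+2) − (q/(q+2)) log q = H_nats(X)`. [folklore] -/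
theorem famEntropy (q k c m : ℕ) (hq : 2 ≤ q) (hk : 1 ≤ k) (hm : 1 ≤ m) (hqk : q * k = k + 1 + c)
    (hent : 2 * Real.negMulLog (1 / ((q : ℝ) + 2)) + Real.negMulLog (1 - 2 * (1 / ((q : ℝ) + 2))) ≤
      Real.binEntropy ((2 * k + 1) / (((q : ℝ) + 2) * k)))
    (P : Fin 3 × Fin 3 × Fin 3 → ℝ)
    (hP : ∀ s, P s = ((if s = (1, 1, 0) then m * (k + 1) else if s = (0, 1, 1) then m * k
        else if s = (1, 0, 1) then m * c else if s = (2, 0, 0) then m * k else 0 : ℕ) : ℝ) /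
          ((((q + 2) * k * m : ℕ)) : ℝ)) :
    Real.log ((q : ℝ) + 2) - (q : ℝ) / ((q : ℝ) + 2) * Real.log (q : ℝ) ≤
      Real.log 2 * (min (shannonEntropy (marginalDist₁ P))
        (min (shannonEntropy (marginalDist₂ P)) (shannonEntropy (marginalDist₃ P))) -
        maxEntropyPenalty cwSupport₃ P) := by
  have hq0 : (0 : ℝ) < q := by exact_mod_cast (by omega : 0 < q)
  have hk0 : (0 : ℝ) < k := by exact_mod_cast hk
  have hm0 : (0 : ℝ) < m := by exact_mod_cast hm
  have hq2 : (0 : ℝ) < (q : ℝ) + 2 := by linarith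
  have hc' : (c : ℝ) = (q : ℝ) * k - k - 1 := by
    have h := congrArg (Nat.cast (R := ℝ)) hqk
    push_cast at h
    linarith
  set θ : ℝ := 1 / ((q : ℝ) + 2) with hθdef
  set p : ℝ := (2 * k + 1) / (((q : ℝ) + 2) * k) with hpdef
  -- the law as probabilities
  have hPp : ∀ s, P s = if s = (1, 1, 0) then p - θ else if s = (0, 1, 1) then θ
      else if s = (1, 0, 1) then 1 - θ - p else if s = (2, 0, 0) then θ else 0 := by
    intro s
    rw [hP s, hθdef, hpdef]
    push_cast
    split_ifs <;>
      first | (rw [hc']; field_simp; ring) | (field_simp; ring) | field_simp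
  -- the probability constraints `0 ≤ θ ≤ p`, `θ + p ≤ 1`
  have hθ0 : 0 ≤ θ := by positivity
  have hθp : θ ≤ p := by
    rw [hθdef, hpdef, div_le_div_iff₀ hq2 (by positivity)]
    nlinarith
  have hθp1 : θ + p ≤ 1 := by
    have e : θ + p = (3 * k + 1) / (((q : ℝ) + 2) * k) := by
      rw [hθdef, hpdef]
      field_simp
      ring
    rw [e, div_le_one (by positivity)]
    nlinarith
  obtain ⟨hm₁, hm₂, hm₃⟩ := marginalDist_fam hPp
  have hpen : maxEntropyPenalty cwSupport₃ P ≤ 0 := maxEntropyPenalty_fam_nonpos hPp hθ0 hθp hθp1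
  have hlog : 0 < Real.log 2 := Real.log_pos one_lt_two
  -- The folklore identities `H(1−p,p,0) = H(p,1−p,0) = h(p)/log 2` are verbatim the tree's
  -- `PerfectAmortisation.shannonEntropy_vec3_eq_binEntropy'` / `…_eq_binEntropy`
  -- (`Theorems/ShapeSubmodularityPerfectAmortisationStubCwRectEntropy.lean`), whose farm olean is unbuilt at
  -- landing time (rc 75 `remote:stale:unbuilt`); proved locally instead of restated (gate rule `dedup.landed`).
  -- TODO(dedup): import that module and `rw` with the tree names once its olean is built.
  have shannonEntropy_vec3_Y : ∀ p : ℝ,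
      shannonEntropy ![1 - p, p, 0] = Real.binEntropy p / Real.log 2 := fun p => by
    rw [shannonEntropy_def, Fin.sum_univ_three, Real.binEntropy_eq_negMulLog_add_negMulLog_one_sub]
    congr 1
    simp only [Matrix.cons_val_zero, Matrix.cons_val_one, Matrix.cons_val_two, Matrix.head_cons,
      Matrix.tail_cons, Real.negMulLog_zero, add_zero]
    ring
  have shannonEntropy_vec3_Z : ∀ p : ℝ,
      shannonEntropy ![p, 1 - p, 0] = Real.binEntropy p / Real.log 2 := fun p => by
    rw [shannonEntropy_def, Fin.sum_univ_three, Real.binEntropy_eq_negMulLog_add_negMulLog_one_sub]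
    congr 1
    simp only [Matrix.cons_val_zero, Matrix.cons_val_one, Matrix.cons_val_two, Matrix.head_cons,
      Matrix.tail_cons, Real.negMulLog_zero, add_zero]
  have hXY : shannonEntropy ![θ, 1 - 2 * θ, θ] ≤ shannonEntropy ![1 - p, p, 0] := by
    rw [shannonEntropy_vec3_X, shannonEntropy_vec3_Y]
    exact div_le_div_of_nonneg_right hent hlog.le
  have hXZ : shannonEntropy ![θ, 1 - 2 * θ, θ] ≤ shannonEntropy ![p, 1 - p, 0] := by
    rw [shannonEntropy_vec3_X, shannonEntropy_vec3_Z]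
    exact div_le_div_of_nonneg_right hent hlog.le
  rw [hm₁, hm₂, hm₃, min_eq_left (le_min hXY hXZ), shannonEntropy_vec3_X, mul_sub,
    mul_div_cancel₀ _ hlog.ne']
  rw [hθdef, entropyX_eq (q : ℝ) hq0]
  have h2 : Real.log 2 * maxEntropyPenalty cwSupport₃ P ≤ 0 :=
    mul_nonpos_of_nonneg_of_nonpos hlog.le hpen
  linarith

/-- Layers B1 + B2: the free diagonal of the joint type `(m(k+1), mk, mc, mk)` with the size bound
in closed form, `exp(N · (log(q+2) − (q/(q+2)) log q)) ≤ |Δ| · (N+1)^63 · 192 · exp(4 √(log 6 + N log 27))`,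
`N = (q+2)km`. [folklore] -/
theorem famDiagonal (q k c m : ℕ) (hq : 2 ≤ q) (hk : 1 ≤ k) (hm : 1 ≤ m)
    (hqk : q * k = k + 1 + c)
    (hent : 2 * Real.negMulLog (1 / ((q : ℝ) + 2)) + Real.negMulLog (1 - 2 * (1 / ((q : ℝ) + 2))) ≤
      Real.binEntropy ((2 * k + 1) / (((q : ℝ) + 2) * k))) :
    ∃ Δ : Finset ((Fin ((q + 2) * k * m) → Fin 3) × (Fin ((q + 2) * k * m) → Fin 3) ×
        (Fin ((q + 2) * k * m) → Fin 3)),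
      (∀ δ ∈ Δ, ∀ ρ, labelSeq δ ρ ∈ cwSupport₃) ∧
      (∀ δ ∈ Δ, letterCount (labelSeq δ) (1, 1, 0) = m * (k + 1) ∧
        letterCount (labelSeq δ) (0, 1, 1) = m * k ∧ letterCount (labelSeq δ) (1, 0, 1) = m * c) ∧
      (∀ δ ∈ Δ, ∀ δ' ∈ Δ, ∀ δ'' ∈ Δ, (∀ ρ, (δ.1 ρ, δ'.2.1 ρ, δ''.2.2 ρ) ∈ cwSupport₃) →
        δ = δ' ∧ δ' = δ'') ∧
      Real.exp (((((q + 2) * k * m : ℕ)) : ℝ) *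
          (Real.log ((q : ℝ) + 2) - (q : ℝ) / ((q : ℝ) + 2) * Real.log (q : ℝ))) ≤
        (Δ.card : ℝ) * ((((((q + 2) * k * m : ℕ)) : ℝ)) + 1) ^ 63 * 192 *
          Real.exp (4 * Real.sqrt (Real.log 6 + ((((q + 2) * k * m : ℕ)) : ℝ) * Real.log 27)) := by
  set P : Fin 3 × Fin 3 × Fin 3 → ℝ := fun s =>
    ((if s = (1, 1, 0) then m * (k + 1) else if s = (0, 1, 1) then m * k
        else if s = (1, 0, 1) then m * c else if s = (2, 0, 0) then m * k else 0 : ℕ) : ℝ) /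
      ((((q + 2) * k * m : ℕ)) : ℝ) with hP
  have hPs : ∀ s, P s = ((if s = (1, 1, 0) then m * (k + 1) else if s = (0, 1, 1) then m * k
      else if s = (1, 0, 1) then m * c else if s = (2, 0, 0) then m * k else 0 : ℕ) : ℝ) /
      ((((q + 2) * k * m : ℕ)) : ℝ) := fun s => rfl
  obtain ⟨Δ, hS, hcnt, hfree, hsize⟩ := famDiagonalRaw q k c m hk hm hqk P hPs
  have hent' := famEntropy q k c m hq hk hm hqk hent P hPs
  refine ⟨Δ, hS, hcnt, hfree, le_trans ?_ hsize⟩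
  set X : ℝ := min (shannonEntropy (marginalDist₁ P))
      (min (shannonEntropy (marginalDist₂ P)) (shannonEntropy (marginalDist₃ P))) -
      maxEntropyPenalty cwSupport₃ P with hX
  have hN0 : (0 : ℝ) ≤ ((((q + 2) * k * m : ℕ)) : ℝ) := Nat.cast_nonneg _
  rw [Real.rpow_def_of_pos two_pos, Real.exp_le_exp]
  calc ((((q + 2) * k * m : ℕ)) : ℝ) *
        (Real.log ((q : ℝ) + 2) - (q : ℝ) / ((q : ℝ) + 2) * Real.log (q : ℝ))
      ≤ ((((q + 2) * k * m : ℕ)) : ℝ) * (Real.log 2 * X) := mul_le_mul_of_nonneg_left hent' hN0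
    _ = Real.log 2 * (((((q + 2) * k * m : ℕ)) : ℝ) * X) := by ring

/-! ## Layer C — the analytic threshold (perfectness: `(q+2)^N = exp(N H_X) · (q^m)^{qk}` exactly) -/

/-- The subexponential loss of the laser method, `(N+1)^63 · 192 · exp(4 √(log 6 + N log 27))`
with `N = (K+2)·M`, is at most `exp(κ·M)` as soon as
`(126 √(K+3) + 4 √(log 6 + (K+2) log 27)) · √M + log 192 ≤ κ·M` (and `K ≥ 0`, `M ≥ 1`)
(copied from the tree's private `PerfectAmortisation.loss_le_exp`). [folklore] -/
theorem loss_le_exp' {K M κ : ℝ} (hK : 0 ≤ K) (hM : 1 ≤ M)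
    (hbound : (126 * √(K + 3) + 4 * √(Real.log 6 + (K + 2) * Real.log 27)) * √M +
      Real.log 192 ≤ κ * M) :
    ((K + 2) * M + 1) ^ 63 * 192 * Real.exp (4 * √(Real.log 6 + (K + 2) * M * Real.log 27)) ≤
      Real.exp (κ * M) := by
  have h6 : 0 ≤ Real.log 6 := Real.log_nonneg (by norm_num)
  have h27 : 0 ≤ Real.log 27 := Real.log_nonneg (by norm_num)
  have hX : 0 ≤ Real.log 6 + (K + 2) * Real.log 27 := add_nonneg h6 (by positivity)
  have hM0 : 0 ≤ M := zero_le_one.trans hM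
  have hN0 : 0 < (K + 2) * M + 1 := by positivity
  have hN1 : (K + 2) * M + 1 ≤ (K + 3) * M := by nlinarith
  have hlog : Real.log ((K + 2) * M + 1) ≤ 2 * √((K + 2) * M + 1) := log_le_two_mul_sqrt hN0
  have hs1 : √((K + 2) * M + 1) ≤ √(K + 3) * √M := by
    rw [← Real.sqrt_mul (by positivity)]
    exact Real.sqrt_le_sqrt hN1
  have hin : Real.log 6 + (K + 2) * M * Real.log 27 ≤ (Real.log 6 + (K + 2) * Real.log 27) * M := by
    nlinarith
  have hs2 : √(Real.log 6 + (K + 2) * M * Real.log 27) ≤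
      √(Real.log 6 + (K + 2) * Real.log 27) * √M := by
    rw [← Real.sqrt_mul hX]
    exact Real.sqrt_le_sqrt hin
  rw [← Real.log_le_iff_le_exp (by positivity), Real.log_mul (by positivity) (by positivity),
    Real.log_mul (by positivity) (by positivity), Real.log_pow, Real.log_exp]
  push_cast
  linarith [hlog, hs1, hs2, hbound]

/-- **Analytic threshold (parametric).**  For `q ≥ 2`, `k ≥ 1`, `δ > 0` there is `m ≥ 1` such that,
with `N = (q+2)km`, every `V : ℕ` with
`exp(N · (log(q+2) − (q/(q+2)) log q)) ≤ V · (N+1)^63 · 192 · exp(4 √(log 6 + N log 27))` satisfies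
the packing certificate `(q+2)^N ≤ V · (q^m)^(qk + δ)`.  The point: `N (log(q+2) − (q/(q+2)) log q)
+ qkm log q = N log(q+2)` EXACTLY (the joint type is `X`-perfect), so only the subexponential loss has
to be absorbed into `(q^m)^δ` (`loss_le_exp'`, `exists_nat_forall_sqrt_le`). [folklore] -/
theorem famThreshold (q k : ℕ) (hq : 2 ≤ q) (hk : 1 ≤ k) :
    ∀ δ : ℝ, 0 < δ → ∃ m : ℕ, 1 ≤ m ∧ ∀ V : ℕ,
      Real.exp (((((q + 2) * k * m : ℕ)) : ℝ) *
          (Real.log ((q : ℝ) + 2) - (q : ℝ) / ((q : ℝ) + 2) * Real.log (q : ℝ))) ≤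
          (V : ℝ) * ((((((q + 2) * k * m : ℕ)) : ℝ)) + 1) ^ 63 * 192 *
            Real.exp (4 * Real.sqrt (Real.log 6 + ((((q + 2) * k * m : ℕ)) : ℝ) * Real.log 27)) →
      ((q : ℝ) + 2) ^ ((q + 2) * k * m) ≤ (V : ℝ) * ((q : ℝ) ^ m) ^ ((q : ℝ) * k + δ) := by
  intro δ hδ
  have hq0 : (0 : ℝ) < q := by exact_mod_cast (by omega : 0 < q)
  have hq1 : (1 : ℝ) < q := by exact_mod_cast (by omega : 1 < q)
  have hk0 : (0 : ℝ) < k := by exact_mod_cast hk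
  have hk1 : (1 : ℝ) ≤ k := by exact_mod_cast hk
  have hq2 : (0 : ℝ) < (q : ℝ) + 2 := by linarith
  have hL : 0 < Real.log (q : ℝ) := Real.log_pos hq1
  -- the threshold
  set c₀ : ℝ := (126 * √((q : ℝ) + 3) + 4 * √(Real.log 6 + ((q : ℝ) + 2) * Real.log 27)) *
    √(k : ℝ) with hc₀
  obtain ⟨m₀, hm₀⟩ := exists_nat_forall_sqrt_le c₀ (Real.log 192) (δ * Real.log (q : ℝ))
    (mul_pos hδ hL)
  obtain ⟨m, hm1, hmm⟩ : ∃ m : ℕ, 1 ≤ m ∧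
      c₀ * √(m : ℝ) + Real.log 192 ≤ δ * Real.log (q : ℝ) * m :=
    ⟨max m₀ 1, le_max_right _ _, hm₀ _ (le_max_left _ _)⟩
  refine ⟨m, hm1, fun V hV => ?_⟩
  have hm0 : (0 : ℝ) < m := by exact_mod_cast hm1
  have hM1 : (1 : ℝ) ≤ (k : ℝ) * m := by
    have : (1 : ℝ) ≤ m := by exact_mod_cast hm1
    nlinarith
  have hN : ((((q + 2) * k * m : ℕ)) : ℝ) = ((q : ℝ) + 2) * ((k : ℝ) * m) := by push_cast; ring
  rw [hN] at hV
  set h : ℝ := Real.log ((q : ℝ) + 2) - (q : ℝ) / ((q : ℝ) + 2) * Real.log (q : ℝ) with hh_def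
  -- Step 1: the loss is at most `exp (δ m log q)`, hence `exp (N h) ≤ V exp (δ m log q)`
  have hbound : (126 * √((q : ℝ) + 3) + 4 * √(Real.log 6 + ((q : ℝ) + 2) * Real.log 27)) *
      √((k : ℝ) * m) + Real.log 192 ≤ δ * Real.log (q : ℝ) / k * ((k : ℝ) * m) := by
    have e1 : (126 * √((q : ℝ) + 3) + 4 * √(Real.log 6 + ((q : ℝ) + 2) * Real.log 27)) *
        √((k : ℝ) * m) = c₀ * √(m : ℝ) := by
      rw [hc₀, Real.sqrt_mul hk0.le]
      ring
    have e2 : δ * Real.log (q : ℝ) / k * ((k : ℝ) * m) = δ * Real.log (q : ℝ) * m := by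
      field_simp
    rw [e1, e2]
    exact hmm
  have hloss := loss_le_exp' hq0.le hM1 hbound
  have eκ : δ * Real.log (q : ℝ) / k * ((k : ℝ) * m) = δ * Real.log (q : ℝ) * m := by
    field_simp
  rw [eκ] at hloss
  have hmain : Real.exp (((q : ℝ) + 2) * ((k : ℝ) * m) * h) ≤
      (V : ℝ) * Real.exp (δ * Real.log (q : ℝ) * m) :=
    calc Real.exp (((q : ℝ) + 2) * ((k : ℝ) * m) * h)
        ≤ (V : ℝ) * (((q : ℝ) + 2) * ((k : ℝ) * m) + 1) ^ 63 * 192 *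
            Real.exp (4 * √(Real.log 6 + ((q : ℝ) + 2) * ((k : ℝ) * m) * Real.log 27)) := hV
      _ = (V : ℝ) * ((((q : ℝ) + 2) * ((k : ℝ) * m) + 1) ^ 63 * 192 *
            Real.exp (4 * √(Real.log 6 + ((q : ℝ) + 2) * ((k : ℝ) * m) * Real.log 27))) := by
          rw [mul_assoc (V : ℝ), mul_assoc (V : ℝ)]
      _ ≤ (V : ℝ) * Real.exp (δ * Real.log (q : ℝ) * m) :=
          mul_le_mul_of_nonneg_left hloss (Nat.cast_nonneg V)
  -- Step 2: `(q+2)^N = exp (N h) · exp (qkm log q)` and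
  -- `(q^m)^(qk+δ) = exp (δ m log q) · exp (qkm log q)`
  have hqm : (0 : ℝ) < (q : ℝ) ^ m := by positivity
  have h10 : ((q : ℝ) + 2) ^ ((q + 2) * k * m) =
      Real.exp (((q : ℝ) + 2) * ((k : ℝ) * m) * h) * Real.exp ((q : ℝ) * k * m * Real.log q) := by
    rw [← Real.exp_add, ← Real.exp_log (by positivity : (0 : ℝ) < ((q : ℝ) + 2) ^ ((q + 2) * k * m)),
      Real.log_pow]
    congr 1
    rw [hh_def]
    push_cast
    field_simp
    ring
  have hexpq : ((q : ℝ) ^ m) ^ ((q : ℝ) * k + δ) =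
      Real.exp (δ * Real.log (q : ℝ) * m) * Real.exp ((q : ℝ) * k * m * Real.log q) := by
    rw [Real.rpow_def_of_pos hqm, Real.log_pow, ← Real.exp_add]
    congr 1
    ring
  rw [h10, hexpq, ← mul_assoc (V : ℝ)]
  exact mul_le_mul_of_nonneg_right hmain (Real.exp_pos _).le

end Summit.MatrixMultiplication.MatrixMultiplication.Theorems.SaturationLadderExpSaturation

end
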